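import Literature.Analysis.FluidPDE.FluidComputerGadgetRobust
import HarnessLib

/-!
# Fluid computer, door N1-FC — from a ONE-SHOT efficiency reading with a DETECTION FLOOR to the ROBUST (kicked) threshold: bookkeeping

HONEST FRAMING: low prior, high value-of-information experiment on Tao's machine paradigm;
NOT a claim that NS blows up.

(Cell `ns-blowup`, seat `ns-blowup-fc-prover-2`, door N1-FC «forced fluid computer». WHAT THIS IS NOT:
not Navier–Stokes evidence and not a reading of any DNS table — exact inequalities between real numbers
and Hilbert-space vectors; the identification of the letters below with the columns of a registered DNS
protocol (a one-shot band-gain reading `ηr`, its detection floor `δ`, a seed of relative energy `ε²`, the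
injection jump `J`) is the cell's MODEL bookkeeping, never the kernel's.)

The robust gadget interface `Literature.Analysis.FluidPDE.FluidComputer.RobustGadgetLibrary`
([cite: Tao2016AveragedNS, §1.3], typed with a stated norm) runs its kicked cascade
(`KickedRun.speed_unbounded`) under the KICKED THRESHOLD `s⁻¹ < theta * eta`: efficiency `eta` of ONE
firing, times the energy-retention factor `theta` of an admissible kick, must beat `1/s`. A one-shot
experiment does not read `eta`; it reads `ηr` with `|ηr - eta| ≤ δ` (detection floor). This file records:

* `kicked_floor_of_reading` — «OneShot → Robust under the detection floor»: `m/s < θ (ηr - δ)` and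
  `|ηr - η| ≤ δ`, `θ ≥ 0` give the kicked `m`-children floor `m/s < θ η`; `kickedThreshold_of_reading` is
  the case `m = 1` in the shape of the tree's hypothesis `σ.s⁻¹ < θ * σ.eta`.
* `half_norm_sq_ge_of_kick` — the MODEL VALUE of the retention factor recorded (not formalised) in
  `FluidComputerGadgetRobust.lean`: for a level energy `E(w) = ‖P w‖² / 2` with `P` `1`-Lipschitz,
  `P 0 = 0` (a band projector), a kick with `‖w - v‖² ≤ rho² E(v)` keeps `E(w) ≥ (1 - rho/√2)² E(v)`.
* `jump_sub_deposit_eq_inner` / `abs_jump_sub_deposit_le` — the injection jump of a band energy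
  `E = ‖·‖²/2` (relative to a reference energy `Eref`) differs from the seed's own deposit by the cross
  term `⟪u, d⟫ / Eref`, bounded by `2 √(E(u)/Eref) √(E(d)/Eref)` (Cauchy–Schwarz): the a-priori size of
  the «measured jump minus nominal deposit» column that enters a detection floor.
* `kickedThreshold_two_of_reading` — the numbers at `s = 2`, one child, seed amplitude `1/10`
  (`theta ≥ 1 - √2/10`, from `(1 - rho/√2)² ≥ 1 - √2 rho`) and a `2 %` floor (`δ = ηr / 50`): a reading
  `ηr ≥ 3/5` implies the kicked threshold `2⁻¹ < θ η` — the bar a one-shot reading must clear before it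
  can instantiate the ROBUST hypothesis is `0.6`, not the Kelvin-critical `0.5`.

0 sorry; axioms ⊆ {propext, Classical.choice, Quot.sound}; no def, no named fact, no instance asserted.
-/

noncomputable section

open scoped RealInnerProductSpace

namespace Summit.NavierStokesRegularity.FluidComputer.GadgetDetectionFloor

open Literature.Analysis.FluidPDE.FluidComputer

/-! ## From a reading with a floor to the kicked threshold -/

/-- **«OneShot → Robust under the detection floor».** If the one-shot READING `ηr` of an efficiency
`η` has detection floor `δ` (`|ηr - η| ≤ δ`), the retention factor `θ` of an admissible kick is
nonnegative, and the reading clears the `m`-children floor robustly — `m / s < θ * (ηr - δ)` — then the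
true efficiency clears the KICKED floor: `m / s < θ * η`. [folklore] -/
theorem kicked_floor_of_reading {s m η ηr δ θ : ℝ} (hθ : 0 ≤ θ) (hread : |ηr - η| ≤ δ)
    (h : m / s < θ * (ηr - δ)) : m / s < θ * η := by
  have h1 : ηr - δ ≤ η := by linarith [(abs_le.1 hread).2]
  exact h.trans_le (mul_le_mul_of_nonneg_left h1 hθ)

/-- The case `m = 1` in the shape of the tree's kicked threshold `σ.s⁻¹ < theta * σ.eta`
(`RobustGadgetLibrary.KickedRun.speed_unbounded`): a reading `ηr` of `σ.eta` with floor `δ` and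
`σ.s⁻¹ < θ * (ηr - δ)` gives `σ.s⁻¹ < θ * σ.eta`. [folklore] -/
theorem kickedThreshold_of_reading (σ : GadgetSpec) {ηr δ θ : ℝ} (hθ : 0 ≤ θ)
    (hread : |ηr - σ.eta| ≤ δ) (h : σ.s⁻¹ < θ * (ηr - δ)) : σ.s⁻¹ < θ * σ.eta := by
  have := kicked_floor_of_reading (m := 1) hθ hread (by rwa [one_div])
  rwa [one_div] at this

/-- Conversely, NO reading below `m/s + δ` can certify even the unkicked floor `m / s < η`: the true
efficiency may sit at `ηr - δ ≤ m / s`. Stated positively: what a reading certifies about `η` is exactly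
`ηr - δ ≤ η ≤ ηr + δ`. [folklore] -/
theorem reading_window {η ηr δ : ℝ} (hread : |ηr - η| ≤ δ) : ηr - δ ≤ η ∧ η ≤ ηr + δ := by
  constructor <;> linarith [(abs_le.1 hread).1, (abs_le.1 hread).2]

/-! ## The model value of the retention factor -/

/-- Square-root form of the kick hypothesis: `‖w - v‖² ≤ rho² (a² / 2)` with `rho, a ≥ 0` gives
`‖w - v‖ ≤ rho a / √2`. [folklore] -/
theorem norm_sub_le_of_sq_le {F : Type*} [NormedAddCommGroup F] {v w : F} {rho a : ℝ}
    (hrho : 0 ≤ rho) (ha : 0 ≤ a) (h : ‖w - v‖ ^ 2 ≤ rho ^ 2 * (a ^ 2 / 2)) :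
    ‖w - v‖ ≤ rho * a / Real.sqrt 2 := by
  have hs : 0 < Real.sqrt 2 := Real.sqrt_pos.2 (by norm_num)
  have hsq : Real.sqrt 2 ^ 2 = 2 := Real.sq_sqrt (by norm_num)
  have hrhs : 0 ≤ rho * a / Real.sqrt 2 := div_nonneg (mul_nonneg hrho ha) hs.le
  refine (pow_le_pow_iff_left₀ (norm_nonneg _) hrhs two_ne_zero).1 ?_
  rw [div_pow, hsq]
  calc ‖w - v‖ ^ 2 ≤ rho ^ 2 * (a ^ 2 / 2) := h
    _ = (rho * a) ^ 2 / 2 := by ring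

/-- **THE MODEL VALUE `theta = (1 - rho/√2)²`** of `FluidComputerGadgetRobust.lean` (there recorded in
prose): for a level energy `E(w) = ‖P w‖² / 2` with `P` `1`-Lipschitz (`‖P a - P b‖ ≤ ‖a - b‖`, e.g. an
orthogonal band projector), a kick `w` of `v` with `‖w - v‖² ≤ rho² E(v)`, `0 ≤ rho ≤ √2`, retains
`E(w) ≥ (1 - rho/√2)² E(v)`: `‖P w‖ ≥ ‖P v‖ - ‖w - v‖ ≥ (1 - rho/√2) ‖P v‖`. [folklore] -/
theorem half_norm_sq_ge_of_kick {F G : Type*} [NormedAddCommGroup F] [NormedAddCommGroup G]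
    (P : F → G) (hP : ∀ a b : F, ‖P a - P b‖ ≤ ‖a - b‖) {v w : F} {rho : ℝ} (hrho : 0 ≤ rho)
    (hrho₂ : rho ≤ Real.sqrt 2) (h : ‖w - v‖ ^ 2 ≤ rho ^ 2 * (‖P v‖ ^ 2 / 2)) :
    (1 - rho / Real.sqrt 2) ^ 2 * (‖P v‖ ^ 2 / 2) ≤ ‖P w‖ ^ 2 / 2 := by
  have hs : 0 < Real.sqrt 2 := Real.sqrt_pos.2 (by norm_num)
  have hkick : ‖w - v‖ ≤ rho * ‖P v‖ / Real.sqrt 2 := norm_sub_le_of_sq_le hrho (norm_nonneg _) h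
  have hc : 0 ≤ 1 - rho / Real.sqrt 2 := by
    rw [sub_nonneg, div_le_one hs]; exact hrho₂
  have hlow : (1 - rho / Real.sqrt 2) * ‖P v‖ ≤ ‖P w‖ := by
    have h1 : ‖P v‖ - ‖P w‖ ≤ ‖P v - P w‖ := norm_sub_norm_le _ _
    have h2 : ‖P v - P w‖ ≤ ‖v - w‖ := hP v w
    rw [norm_sub_rev v w] at h2
    have : (1 - rho / Real.sqrt 2) * ‖P v‖ = ‖P v‖ - rho * ‖P v‖ / Real.sqrt 2 := by ring
    linarith
  have hsq := mul_self_le_mul_self (mul_nonneg hc (norm_nonneg _)) hlow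
  nlinarith [hsq]

/-! ## The injection cross term -/

/-- The injection jump of the energy `‖·‖² / 2`, relative to a reference energy `Eref`, minus the
seed's own deposit, IS the cross term: `((‖u + d‖² - ‖u‖²)/2)/Eref - (‖d‖²/2)/Eref = ⟪u, d⟫ / Eref`.
[folklore] -/
theorem jump_sub_deposit_eq_inner {F : Type*} [NormedAddCommGroup F] [InnerProductSpace ℝ F]
    (u d : F) (Eref : ℝ) :
    (‖u + d‖ ^ 2 / 2 - ‖u‖ ^ 2 / 2) / Eref - (‖d‖ ^ 2 / 2) / Eref = ⟪u, d⟫ / Eref := by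
  have h := norm_add_sq_real u d
  have : ‖u + d‖ ^ 2 / 2 - ‖u‖ ^ 2 / 2 - ‖d‖ ^ 2 / 2 = ⟪u, d⟫ := by linarith
  rw [← this]
  ring

/-- **A-PRIORI SIZE OF «JUMP MINUS DEPOSIT»** (Cauchy–Schwarz): with `E(x) = ‖x‖²/2`,
`|J - ε²| ≤ 2 √(E(u)/Eref) √(E(d)/Eref)` where `J = (E(u+d) - E(u))/Eref` is the relative jump and
`ε² = E(d)/Eref` the relative deposit — twice the geometric mean of the relative energies of host-in-band
and seed. [folklore] -/
theorem abs_jump_sub_deposit_le {F : Type*} [NormedAddCommGroup F] [InnerProductSpace ℝ F]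
    (u d : F) {Eref : ℝ} (hE : 0 < Eref) :
    |(‖u + d‖ ^ 2 / 2 - ‖u‖ ^ 2 / 2) / Eref - (‖d‖ ^ 2 / 2) / Eref| ≤
      2 * Real.sqrt (‖u‖ ^ 2 / 2 / Eref) * Real.sqrt (‖d‖ ^ 2 / 2 / Eref) := by
  rw [jump_sub_deposit_eq_inner, abs_div, abs_of_pos hE]
  have hcs : |⟪u, d⟫| ≤ ‖u‖ * ‖d‖ := abs_real_inner_le_norm u d
  have hsq : ∀ x : F, Real.sqrt (‖x‖ ^ 2 / 2 / Eref) = ‖x‖ / Real.sqrt (2 * Eref) := by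
    intro x
    rw [div_div, Real.sqrt_div' _ (by positivity : 0 ≤ 2 * Eref), Real.sqrt_sq (norm_nonneg _)]
  rw [hsq u, hsq d]
  have h2 : 0 < Real.sqrt (2 * Eref) := Real.sqrt_pos.2 (by positivity)
  have hs2 : Real.sqrt (2 * Eref) ^ 2 = 2 * Eref := Real.sq_sqrt (by positivity)
  rw [div_le_iff₀ hE]
  calc |⟪u, d⟫| ≤ ‖u‖ * ‖d‖ := hcs
    _ = 2 * (‖u‖ / Real.sqrt (2 * Eref)) * (‖d‖ / Real.sqrt (2 * Eref)) * Eref := by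
        field_simp
        rw [hs2]
        ring

/-! ## The numbers at `s = 2`, one child, seed amplitude `1/10`, `2 %` floor -/

/-- `(1 - rho/√2)² ≥ 1 - √2 · rho` for every real `rho` (drop the square term). [folklore] -/
theorem one_sub_div_sqrt_two_sq_ge (rho : ℝ) :
    1 - Real.sqrt 2 * rho ≤ (1 - rho / Real.sqrt 2) ^ 2 := by
  have hs : 0 < Real.sqrt 2 := Real.sqrt_pos.2 (by norm_num)
  have hsq : Real.sqrt 2 ^ 2 = 2 := Real.sq_sqrt (by norm_num)
  have hid : Real.sqrt 2 * rho = 2 * (rho / Real.sqrt 2) := by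
    field_simp
    rw [hsq]
    ring
  rw [hid]
  nlinarith [sq_nonneg (rho / Real.sqrt 2)]

/-- `√2 ≤ 1.415`. [folklore] -/
theorem sqrt_two_le : Real.sqrt 2 ≤ 1.415 := by
  rw [show (1.415 : ℝ) = Real.sqrt (1.415 ^ 2) from (Real.sqrt_sq (by norm_num)).symm]
  exact Real.sqrt_le_sqrt (by norm_num)

/-- **THE BAR AT `s = 2`.** One child, seed of relative amplitude `rho = 1/10` (so any retention factor
`θ ≥ (1 - rho/√2)²`, in particular `θ ≥ 1 - √2/10`), detection floor `2 %` of the reading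
(`|ηr - η| ≤ ηr / 50`): a one-shot reading `ηr ≥ 3/5` implies the KICKED threshold `2⁻¹ < θ * η`. The
Kelvin-critical reading `ηr = 1/2` does not (take `η = ηr`, `θ < 1`). MODEL bookkeeping: the letters are
real numbers, not DNS columns. [folklore] -/
theorem kickedThreshold_two_of_reading {η ηr θ : ℝ} (hθ : 1 - Real.sqrt 2 / 10 ≤ θ)
    (hread : |ηr - η| ≤ ηr / 50) (hr : 3 / 5 ≤ ηr) : (2 : ℝ)⁻¹ < θ * η := by
  have hθpos : 0 ≤ θ := by linarith [sqrt_two_le]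
  have hθlow : 0.8585 ≤ θ := by linarith [sqrt_two_le]
  refine kicked_floor_of_reading (m := 1) hθpos hread ?_ |> fun h => by rwa [one_div] at h
  have h49 : ηr - ηr / 50 = 49 / 50 * ηr := by ring
  rw [h49, one_div]
  nlinarith

end Summit.NavierStokesRegularity.FluidComputer.GadgetDetectionFloor

end
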